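import Summits.CriticalPhenomena.PercolationContinuityZ3.Theorems.PercAnnulusCrossingIICCapacityEnergy
import HarnessLib

/-!
# The one-arm capacity of a sparse set is additive: `Cap(S) ≍ |S|` while `|S|·π(separation) ≤ 1` (lane RSW3, p1 gen 26)

builds on p205010 (kernel theorem, internal audit signed; external expert review pending) — NOT used in this file (every `d ≥ 1`,
`p > 0`; `(QM)_c`, the one-arm ratio bound `B`; the energy bound of `…IICCapacityEnergy`).

RSW3 lane (LANE 3 `prim-rsw3`), seat `prim-rsw3-p1` (gen 26).  Helper file (`--supports stmt-CriticalPhenomena-4575`); no definitions,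
no sorries.  Memo `run/shared/lean/prim/rsw3/P1-QM.md` §39.4.

For `S ⊆ Λ(m)` whose sites are pairwise at sup-distance `≥ r ≥ 3`, the `π`-energy at uniform weights is
`Σ_{q,q'} π(⌊(‖q'−q‖−1)/2⌋) ≤ |S|·(1 + B·|S|·π_p(r))` (diagonal `π(0) = 1`, off-diagonal `≤ Bπ(‖q'−q‖) ≤ Bπ(r)`), so the energy bound
(`…IICCapacityEnergy`) gives **`π_p(ρ)·|S| ≤ B³(1+B/c) · P_p(L(S,ρ)) · (1 + B|S|π_p(r))`** (`ρ ≥ 4m+2`); with the union bound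
`P(L(S,ρ)) ≤ B|S|π(ρ)`: **THE ONE-ARM CAPACITY OF `k` POINTS AT MUTUAL DISTANCE `≥ r` IS `≍ k` AS LONG AS `k·π(r) ≤ 1`** — `k` far-apart
points are `k` times as visible from infinity as one point (under Kesten's IIC, with `…IICCapacity`: `ν(C(0) ∋ one of them) ≍ k·π(dist)`).
* `sum_sum_kernel_le_of_separated` — the energy of a separated set;
* **`oneArmProb_mul_card_le_of_separated`** — the capacity lower bound;
* `oneArmProb_mul_card_le_of_separated_of_small` — `k·π(r) ≤ 1`: `π(ρ)·|S| ≤ B³(1+B/c)(1+B)·P(L(S,ρ))`.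
References: R. Lyons, Y. Peres, *Probability on Trees and Networks* (2016) §5.3; H. Kesten, PTRF 73 (1986) Thm. (8).
-/

noncomputable section

namespace Summit.CriticalPhenomena.PercolationContinuityZ3.Theorems.Crossing

open MeasureTheory Filter Topology Literature.Probability.Percolation Literature.Probability.LatticeModels
open Literature.Probability.Percolation.DCT16
open Summit.CriticalPhenomena.PercolationContinuityZ3.Theorems.SurfaceTension

variable {d : ℕ}

open Classical in
/-- **The `π`-energy of an `r`-separated set at uniform weights**: if the sites of `S` are pairwise at sup-distance `≥ r` (`r ≥ 3`), then
`Σ_{q,q'∈S} π_p(⌊(‖q'−q‖−1)/2⌋) ≤ |S|·(1 + B·|S|·π_p(r))`. [cite: Kesten1986, Thm. (8)] -/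
theorem sum_sum_kernel_le_of_separated (hd : 1 ≤ d) (p : unitInterval) {B : ℝ} (hB : 0 ≤ B)
    (hR : ∀ j n : ℕ, 1 ≤ j → j ≤ n → n ≤ 8 * j → oneArmProb d p j ≤ B * oneArmProb d p n)
    {r : ℕ} (hr : 3 ≤ r) (S : Finset (Site d)) (hsep : ∀ q ∈ S, ∀ q' ∈ S, q ≠ q' → r ≤ Site.supNorm (q' - q)) :
    ∑ q ∈ S, ∑ q' ∈ S, oneArmProb d p ((Site.supNorm (q' - q) - 1) / 2) ≤
      (S.card : ℝ) * (1 + B * (S.card : ℝ) * oneArmProb d p r) := by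
  classical
  have hπ0 : ∀ n, 0 ≤ oneArmProb d p n := fun n => measureReal_nonneg
  have hanti : ∀ {a b : ℕ}, a ≤ b → oneArmProb d p b ≤ oneArmProb d p a := fun h => DCT16.real_siteToBoundary_antitone _ h
  have hterm : ∀ q ∈ S, ∀ q' ∈ S,
      oneArmProb d p ((Site.supNorm (q' - q) - 1) / 2) ≤ (if q' = q then (1 : ℝ) else 0) + B * oneArmProb d p r := by
    intro q hq q' hq'
    by_cases hqq : q' = q
    · rw [if_pos hqq, hqq, sub_self]
      have h0 : Site.supNorm (0 : Site d) = 0 := Site.supNorm_eq_zero_iff.2 rfl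
      rw [h0, Rsw3.oneArmProb_zero hd p]
      exact le_add_of_nonneg_right (mul_nonneg hB (hπ0 r))
    · rw [if_neg hqq, zero_add]
      have hn := hsep q hq q' hq' (Ne.symm hqq)
      exact (oneArmProb_half_le p hR (le_trans hr hn)).trans (mul_le_mul_of_nonneg_left (hanti hn) hB)
  calc ∑ q ∈ S, ∑ q' ∈ S, oneArmProb d p ((Site.supNorm (q' - q) - 1) / 2)
      ≤ ∑ q ∈ S, ∑ q' ∈ S, ((if q' = q then (1 : ℝ) else 0) + B * oneArmProb d p r) :=
        Finset.sum_le_sum fun q hq => Finset.sum_le_sum fun q' hq' => hterm q hq q' hq'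
    _ = ∑ q ∈ S, (1 + (S.card : ℝ) * (B * oneArmProb d p r)) := by
        refine Finset.sum_congr rfl fun q hq => ?_
        rw [Finset.sum_add_distrib, Finset.sum_ite_eq' S q (fun _ => (1 : ℝ)), if_pos hq, Finset.sum_const, nsmul_eq_mul]
    _ = (S.card : ℝ) * (1 + B * (S.card : ℝ) * oneArmProb d p r) := by
        rw [Finset.sum_const, nsmul_eq_mul]; ring

open Classical in
/-- **THE ONE-ARM CAPACITY OF A SEPARATED SET IS ADDITIVE** (every `d ≥ 1`, `p > 0`; `(QM)_c`; ratio bound `B`; `1 ≤ m`, `4m+2 ≤ ρ`;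
`S ⊆ Λ(m)` with pairwise sup-distances `≥ r ≥ 3`):
**`π_p(ρ)·|S| ≤ B³(1 + B/c) · P_p(∃ q ∈ S, q ↔ ∂ⁱⁿΛ(ρ) in Λ(ρ)) · (1 + B·|S|·π_p(r))`** — with the union bound `P(L(S,ρ)) ≤ B|S|π(ρ)`:
`Cap_ρ(S) ≍ |S|` as long as `|S|·π(r) ≤ 1`. [cite: LyonsPeres2016, §5.3 Prop. 5.11] [cite: Kesten1986, Thm. (8)] -/
theorem oneArmProb_mul_card_le_of_separated (hd : 1 ≤ d) (p : unitInterval) (hp : 0 < (p : ℝ)) {c : ℝ} (hc : 0 < c)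
    (hQM : OneArmQuasiMultAt d p c) {B : ℝ} (hB : 0 < B)
    (hR : ∀ j n : ℕ, 1 ≤ j → j ≤ n → n ≤ 8 * j → oneArmProb d p j ≤ B * oneArmProb d p n)
    {m ρ r : ℕ} (hm : 1 ≤ m) (hρ : 4 * m + 2 ≤ ρ) (hr : 3 ≤ r) (S : Finset (Site d)) (hS : S ⊆ box d m)
    (hsep : ∀ q ∈ S, ∀ q' ∈ S, q ≠ q' → r ≤ Site.supNorm (q' - q)) :
    oneArmProb d p ρ * (S.card : ℝ) ≤ B ^ 3 * (1 + B / c) *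
      (bondPercolation (zdGraph d) p).real {ω : BondConfig (Site d) | ∃ q ∈ S,
        ∃ t ∈ innerBoundary (zdGraph d) (box d ρ), ω ∈ openConnIn (↑(box d ρ) : Set (Site d)) q t} *
      (1 + B * (S.card : ℝ) * oneArmProb d p r) := by
  classical
  rcases S.eq_empty_or_nonempty with rfl | hne
  · simp
  have hcard : 0 < (S.card : ℝ) := by exact_mod_cast hne.card_pos
  set P := (bondPercolation (zdGraph d) p).real {ω : BondConfig (Site d) | ∃ q ∈ S,
    ∃ t ∈ innerBoundary (zdGraph d) (box d ρ), ω ∈ openConnIn (↑(box d ρ) : Set (Site d)) q t} with hP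
  have hP0 : 0 ≤ P := measureReal_nonneg
  have h := oneArmProb_mul_card_sq_le hd p hp hc hQM hB hR hm hρ S hS
  rw [← hP] at h
  have hE := sum_sum_kernel_le_of_separated hd p hB.le hR hr S hsep
  have hK0 : 0 ≤ B ^ 3 * (1 + B / c) * P := by positivity
  have hkey : (S.card : ℝ) * (oneArmProb d p ρ * (S.card : ℝ)) ≤
      (S.card : ℝ) * (B ^ 3 * (1 + B / c) * P * (1 + B * (S.card : ℝ) * oneArmProb d p r)) := by
    calc (S.card : ℝ) * (oneArmProb d p ρ * (S.card : ℝ)) = oneArmProb d p ρ * (S.card : ℝ) ^ 2 := by ring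
      _ ≤ B ^ 3 * (1 + B / c) * P * ∑ q ∈ S, ∑ q' ∈ S, oneArmProb d p ((Site.supNorm (q' - q) - 1) / 2) := h
      _ ≤ B ^ 3 * (1 + B / c) * P * ((S.card : ℝ) * (1 + B * (S.card : ℝ) * oneArmProb d p r)) :=
          mul_le_mul_of_nonneg_left hE hK0
      _ = (S.card : ℝ) * (B ^ 3 * (1 + B / c) * P * (1 + B * (S.card : ℝ) * oneArmProb d p r)) := by ring
  exact le_of_mul_le_mul_left hkey hcard

open Classical in
/-- **`k` FAR-APART POINTS ARE `k` TIMES AS VISIBLE AS ONE**: if moreover `|S|·π_p(r) ≤ 1`, then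
**`π_p(ρ)·|S| ≤ B³(1 + B/c)(1 + B) · P_p(∃ q ∈ S, q ↔ ∂ⁱⁿΛ(ρ) in Λ(ρ))`** (and `P(…) ≤ B|S|π(ρ)` by the union bound).
[cite: LyonsPeres2016, §5.3 Prop. 5.11] [cite: Kesten1986, Thm. (8)] -/
theorem oneArmProb_mul_card_le_of_separated_of_small (hd : 1 ≤ d) (p : unitInterval) (hp : 0 < (p : ℝ)) {c : ℝ} (hc : 0 < c)
    (hQM : OneArmQuasiMultAt d p c) {B : ℝ} (hB : 0 < B)
    (hR : ∀ j n : ℕ, 1 ≤ j → j ≤ n → n ≤ 8 * j → oneArmProb d p j ≤ B * oneArmProb d p n)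
    {m ρ r : ℕ} (hm : 1 ≤ m) (hρ : 4 * m + 2 ≤ ρ) (hr : 3 ≤ r) (S : Finset (Site d)) (hS : S ⊆ box d m)
    (hsep : ∀ q ∈ S, ∀ q' ∈ S, q ≠ q' → r ≤ Site.supNorm (q' - q)) (hsmall : (S.card : ℝ) * oneArmProb d p r ≤ 1) :
    oneArmProb d p ρ * (S.card : ℝ) ≤ B ^ 3 * (1 + B / c) * (1 + B) *
      (bondPercolation (zdGraph d) p).real {ω : BondConfig (Site d) | ∃ q ∈ S,
        ∃ t ∈ innerBoundary (zdGraph d) (box d ρ), ω ∈ openConnIn (↑(box d ρ) : Set (Site d)) q t} := by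
  have h := oneArmProb_mul_card_le_of_separated hd p hp hc hQM hB hR hm hρ hr S hS hsep
  set P := (bondPercolation (zdGraph d) p).real {ω : BondConfig (Site d) | ∃ q ∈ S,
    ∃ t ∈ innerBoundary (zdGraph d) (box d ρ), ω ∈ openConnIn (↑(box d ρ) : Set (Site d)) q t} with hP
  have hP0 : 0 ≤ P := measureReal_nonneg
  have h1 : 1 + B * (S.card : ℝ) * oneArmProb d p r ≤ 1 + B := by
    have : B * ((S.card : ℝ) * oneArmProb d p r) ≤ B * 1 := mul_le_mul_of_nonneg_left hsmall hB.le
    linarith [this]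
  have hK0 : 0 ≤ B ^ 3 * (1 + B / c) * P := by positivity
  exact h.trans ((mul_le_mul_of_nonneg_left h1 hK0).trans (le_of_eq (by ring)))

end Summit.CriticalPhenomena.PercolationContinuityZ3.Theorems.Crossing

end
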